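import Summits.BirchSwinnertonDyer.BirchSwinnertonDyer.Theorems.PrintX8SharpFlatMuDefect
import Summits.BirchSwinnertonDyer.BirchSwinnertonDyer.Theorems.PrintX8VerticalStevensCollapse
import Summits.BirchSwinnertonDyer.BirchSwinnertonDyer.Theorems.PrintX8VerticalStevensSpan
import Summits.BirchSwinnertonDyer.BirchSwinnertonDyer.Theorems.SignedLowerHalvesSprungLowerDivisibilityAtThreeSqueezeToCommonZerosContra
import Literature.NumberTheory.EllipticCurves.Sprung2012.SharpFlatColemanKatoContragredient
import Literature.NumberTheory.EllipticCurves.Kato2004.FineSelmerDualInvolutionInvariantsProofs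
import Literature.NumberTheory.EllipticCurves.Rank1Residual.CyclotomicWindingSpan
import HarnessLib

/-!
# Route `PrintX8VSC` (print-keyed twin of `PrintX8VS`), glue item `GlueSharpFlatMainConjectureOfKatoSporadicX8Contra`
# (stmt-BirchSwinnertonDyer-23743) — PART 2b: the `μ`-bound `μ(X^•) ≤ μ(Λ/(L^•))` on the SMALL-IMAGE X8 pairs for the
# PRINT-KEYED dual `X^•(E/ℚ_∞) = D(γ⁻¹)`, from THEOREM B (`ConjSpanGen` at every level prime to `3`) and the
# CONTRAGREDIENT ♯/♭ Coleman–Kato package (`thm714seq_sharpFlatColemanKato_zeta[_Joint]_contra`) — the print-key port of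
# `PrintX8VSGlue.muBoundSmallImageX8_of_conjSpanGenAll` ∘ `PrintX8VerticalStevens.muBoundSmallImageX8_of_…` ∘
# `PrintX8SharpFlatMuTransfer` §3–§4

Cell `bsd-ssimc`, width seat `cruxlead-stmt-BirchSwinnertonDyer-19875-w2` (gen 11) under the 19875 LEAD; `--supports`
stmt-BirchSwinnertonDyer-23743; THEOREMS ONLY; route-independent (no `Theses` import; the span hypothesis is the BODY of
`PrintX8VSC.ConjSpanGenAll` = `PrintX8VS.ConjSpanGenAll`, item 21705, PROVED). HONEST FRAMING: a PORT, token for token, of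
the landed `γ`-keyed `μ`-chain to the contragredient package `SharpFlatColemanKatoDataContra` (p662311) and the `γ⁻¹`-keyed
duals; the analytic half (VS-0 ⟹ VS-1 ⟹ one colour of unit content: `eisSpanModGen_of_conjSpanGen`,
`PrintX8VerticalStevens.cycWindingNonConstantSmallImageX8_of_spanModAtThree`,
`PrintX8VerticalStevensCollapse.ClassX8.exists_hasUnitContent_chromaticL_of_cycWindingNonConstant`) is keying-free and cited
by name; the Euler-system core (`SmallImageSignedMuTransfer.fineSelmerDual_lengthAt_augIdealP_eq_zero_of_eulerSystemClass`,
reduction-free, on the covariant `𝐇¹`) is keying-free; ONLY the package whose fields `colMap`/`Z`/`zeta_le_span`/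
`image_zeta_localized` feed the core and whose field `exact` gives LEMMA B is now the CONTRAGREDIENT one, and the fine /
♯/♭ duals are keyed `γ⁻¹` (lengths at the `ι`-FIXED prime `(p)` transported by the PROVED dictionary
`Kato2004.fineSelmerDualData_lengthAt_inv_eq_of_asIdeal_eq_augIdealP`). Referee N-287b honoured: no `γ`-keyed fact at `γ⁻¹`.
No new mathematics; the `μ`-bound is NOT in print at `a₃ = ±3` as a stand-alone theorem but IS a kernel theorem modulo
THEOREM B (proved) + the contragredient package (print, Sprung 2012 Def. 6.1/(3)/Kato 12.6) + the period unit — exactly as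
its `γ`-keyed twin (p561175/p564724). MC′, K′, C′, leaf X8 and BSD are NOT proved.

* §1 `fine_lengthAt_eq_zero_of_sharpFlatUnitContent_contra` — odd good `p ∣ a_p`, `ρ̄_{E,p}` NOT onto, `|ϖ|_p = 1`, ONE
  colour `•₀` of unit content, the CONTRAGREDIENT `•₀`-package ⟹ `ℓ_{(p)} X₀ = 0` for EVERY fine dual datum of key `γ`
  (port of `PrintX8SharpFlatMuTransfer.fine_lengthAt_eq_zero_of_sharpFlatUnitContent`); `…_inv` — the same for key `γ⁻¹`.
* §2 LEMMA B, print keying: `ℓ_{(p)} X₀(γ⁻¹) = 0 ⟹ ℓ_{(p)} D(γ⁻¹).X ≤ ℓ_{(p)} Λ/(L^•)` (LEAD g6's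
  `SharpFlatColemanKatoDataContra.lengthAt_le_fine_add`, p668614); X8 `μ`-currency form.
* §3 per pair: X8, not onto, ONE colour of unit content ⟹ `μ(D(γ⁻¹).X) ≤ μ(Λ/(L^•))` for EVERY colour `•` with `L^• ≠ 0`.
* §4 class forms: THEOREM B's conclusion (`ConjSpanGen N 3`, all `N` prime to `3`) + the contragredient package (one-colour
  `thm714seq_sharpFlatColemanKato_zeta_contra`, or the JOINT `…_zetaJoint_contra` = conjunct (3) of `HeldInputsX8RContra`) +
  the period unit at `3` ⟹ the `μ`-bound on every small-image X8 pair, every colour, every `γ⁻¹`-keyed datum.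

References: [Sprung2012] Def. 6.1 (p. 1495), Thm. 7.14 (3) (p. 1504), Prop. 7.19 (p. 1505), §7.5 l.1; [Kato2004Asterisque]
Thm. 12.6 (p. 222), §13.8 (pp. 228–229), §17.13 (p. 280); [Pollack2003] Def. 6.15; [Sprung2017] Cor. 4.10, Thm. 1.12;
[GreenbergVatsal2000] §3 Rem. 3.4; [Washington1997] §13.2; [GreenbergLNM1716] §1 (p. 60).
-/

set_option autoImplicit false
-- justification: the mandated namespace `Summit.BirchSwinnertonDyer.BirchSwinnertonDyer.Theorems`
-- (single-conjunct summit, Sub = Summit) repeats a segment by design (D-0017).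
set_option linter.dupNamespace false

noncomputable section

open scoped Classical NumberField MatrixGroups ModularForm

open NumberField IsDedekindDomain WeierstrassCurve CongruenceSubgroup Field
  Literature.NumberTheory.EllipticCurves Literature.NumberTheory.EllipticCurves.ModularForms
  Literature.NumberTheory.EllipticCurves.Rank1Residual
  Literature.NumberTheory.EllipticCurves.Sprung2017 Literature.NumberTheory.EllipticCurves.Sprung2012
  Literature.NumberTheory.EllipticCurves.Kato2004 Literature.NumberTheory.EllipticCurves.GreenbergVatsal2000
  Literature.NumberTheory.EllipticCurves.ZpExtension Literature.NumberTheory.EllipticCurves.IwasawaAlgebra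
  Summit.BirchSwinnertonDyer.BirchSwinnertonDyer.Rank1Residual
  Summit.BirchSwinnertonDyer.BirchSwinnertonDyer.Theorems
  Summit.BirchSwinnertonDyer.BirchSwinnertonDyer.Theorems.SmallImageSignedMuTransfer
  Summit.BirchSwinnertonDyer.BirchSwinnertonDyer.Theorems.SmallImageSignedMuDefect
  Summit.BirchSwinnertonDyer.BirchSwinnertonDyer.Theorems.PrintX8SharpFlatMuTransfer
  Summit.BirchSwinnertonDyer.BirchSwinnertonDyer.Theorems.PrintX8VerticalStevensCollapse
  Summit.BirchSwinnertonDyer.Rank1Residual.Supersingular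

namespace Summit.BirchSwinnertonDyer.BirchSwinnertonDyer.Theorems.X8MainConjectureContra

/-! ### §1 ONE colour's unit content + the CONTRAGREDIENT package ⟹ `ℓ_{(p)} X₀ = 0` -/

section FineZero

variable (W : WeierstrassCurve ℚ) [W.IsElliptic] [W.IsGloballyMinimal] (p : ℕ) [Fact p.Prime]

/-- **One colour's rider ⟹ `ℓ_{(p)} X₀(E/ℚ_∞) = 0`, through the CONTRAGREDIENT package** (odd good `p ∣ a_p`,
`ρ̄_{E,p}` NOT onto, newform `f`, `|ϖ|_p = 1`; SOME colour `•₀` with `HasUnitContent (L^{•₀})` ⟹ every dual fine Selmer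
datum of key `γ` over the cyclotomic `(κ, γ)` has `ℓ_{(p)} X₀ = 0`): the contragredient `•₀`-package's localized image
clause and `G₀ ∉ (p)` give a genuine Euler-system class outside `p𝐇¹` (`exists_mem_set_not_mem_pSmul` — the fields
`colMap`, `Z`, `zeta_le_span`, `image_zeta_localized` are common to both packages), and the reduction-free core
(`fineSelmerDual_lengthAt_augIdealP_eq_zero_of_eulerSystemClass`, on the covariant `𝐇¹`) concludes. Port of
`PrintX8SharpFlatMuTransfer.fine_lengthAt_eq_zero_of_sharpFlatUnitContent` with `SharpFlatColemanKatoDataContra` for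
`SharpFlatColemanKatoData`. [cite: Kato2004Asterisque, Thm. 12.6 (p. 222), §13.8 (pp. 228–229)]
[cite: Sprung2012, Def. 6.1 (p. 1495), Thm. 7.14 (3) (p. 1504)] -/
theorem fine_lengthAt_eq_zero_of_sharpFlatUnitContent_contra
    (hCKc : thm714seq_sharpFlatColemanKato_zeta_contra)
    (hp : p ≠ 2) (hgood : W.HasGoodReductionAtPrime p) (hap : (p : ℤ) ∣ W.frobeniusTrace p)
    (hns : ¬ W.HasSurjectiveModNGaloisRep p)
    {N : ℕ} [NeZero N] (f : CuspForm (Gamma0 N) 2) (hf : IsNewformOf W f)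
    (ϖ : ℚ) (hϖ : (ϖ : ℝ) * W.realPeriodRat = plusPeriod f) (hϖ1 : ‖(ϖ : ℚ_[p])‖ = 1)
    (κ : ZpExtension ℚ p) (γ : absoluteGaloisGroup ℚ) (hκ : κ.IsCyclotomic) (hγ : κ.IsTopGenerator γ)
    (hγ' : IsCyclotomicVariable p γ)
    (v : HeightOneSpectrum (𝓞 ℚ)) (hv : (p : 𝓞 ℚ) ∈ v.asIdeal)
    (g : absoluteGaloisGroup (v.adicCompletion ℚ))
    (hg : κ.IsTopGenerator (resGalOfEmb (closureEmb (K := ℚ) (v.adicCompletion ℚ)) g))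
    (cneg : localPoints W (v.adicCompletion ℚ)) (c : ℕ → localPoints W (v.adicCompletion ℚ))
    (hH : IsHondaSystem κ (closureEmb (K := ℚ) (v.adicCompletion ℚ)) W (W.frobeniusTrace p) g cneg c)
    (col₀ : Chroma) {Lsharp Lflat : IwasawaAlgebra p}
    (hSP : IsSprungPair f p (W.frobeniusTrace p) Lsharp Lflat)
    (hu₀ : HasUnitContent (chromaticL col₀ Lsharp Lflat))
    (Y : W.FineSelmerDualData κ γ) (𝔭 : PrimeSpectrum (IwasawaAlgebra p))
    (h𝔭 : 𝔭.asIdeal = IwasawaAlgebra.augIdealP p) :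
    Module.lengthAt (IwasawaAlgebra p) Y.X 𝔭 = 0 := by
  haveI : ContinuousSMul ℤ_[p] (W.tateModule p) := TateModule.continuousSMul_padicInt
  haveI : Module.Free ℤ_[p] (W.tateModule p) := W.module_free_tateModule_holds p
  haveI : Module.Finite ℤ_[p] (W.tateModule p) := W.module_finite_tateModule_holds p
  have hirr : W.HasIrreducibleModPGaloisRep p :=
    hasIrreducibleModPGaloisRep_of_dvd_frobeniusTrace W p hp
      (W.not_dvd_minimalDiscriminantInt_of_hasGoodReductionAtPrime' p hgood) hap
  obtain ⟨I⟩ := nonempty_iwasawaH1Data_holds W p κ γ hκ hγ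
  obtain ⟨K₀⟩ := hCKc W p f ϖ κ γ hp hgood hap hf hϖ hκ hγ hγ' v hv g hg cneg c hH col₀ I
  set L₀ : IwasawaAlgebra p := chromaticL col₀ Lsharp Lflat with hL₀def
  obtain ⟨-, hι₀⟩ := span_C_units_mul_eq (PadicInt.mkUnits hϖ1) L₀
  set G₀ : IwasawaAlgebra p := PowerSeries.C ((PadicInt.mkUnits hϖ1 : ℤ_[p]ˣ) : ℤ_[p]) * L₀ with hG₀def
  have hG₀ : iwasawaToPowerSeries p G₀ =
      PowerSeries.C ((ϖ : ℚ) : ℚ_[p]) * iwasawaToPowerSeries p L₀ := by rw [hι₀, PadicInt.mkUnits_eq]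
  have hL₀p : L₀ ∉ IwasawaAlgebra.augIdealP p := KatoMuSkeleton.not_mem_augIdealP_of_hasUnitContent hu₀
  have hG₀p : G₀ ∉ IwasawaAlgebra.augIdealP p := by
    intro h
    apply hL₀p
    have h' := Ideal.mul_mem_left (IwasawaAlgebra.augIdealP p)
      (PowerSeries.C (((PadicInt.mkUnits hϖ1)⁻¹ : ℤ_[p]ˣ) : ℤ_[p])) h
    rwa [hG₀def, ← mul_assoc, ← map_mul, Units.inv_mul, map_one, one_mul] at h'
  have h𝔭1 : 𝔭.asIdeal.height = 1 := by rw [h𝔭]; exact IwasawaAlgebra.height_augIdealP_holds p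
  obtain ⟨s₀, hs₀, hs₀G, -⟩ := K₀.image_zeta_localized hirr Lsharp Lflat G₀ hSP hG₀ 𝔭 h𝔭1
  have hs₀' : s₀ ∉ IwasawaAlgebra.augIdealP p := h𝔭 ▸ hs₀
  obtain ⟨z, hzES, hzp⟩ := exists_mem_set_not_mem_pSmul K₀.colMap K₀.Z K₀.zeta_le_span hs₀' hG₀p hs₀G
  exact (fineSelmerDual_lengthAt_augIdealP_eq_zero_of_eulerSystemClass W p κ γ I hp hirr hns hκ hγ
    ⟨z, hzES, hzp⟩ Y 𝔭 h𝔭).2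

/-- **The same for a fine dual datum of key `γ⁻¹`** (the printed `X₀(E/ℚ_∞)`): `(p)` is an `ι`-fixed prime, so the two
keyings have the same length there (`Kato2004.fineSelmerDualData_lengthAt_inv_eq_of_asIdeal_eq_augIdealP`).
[cite: Kato2004Asterisque, Thm. 12.6 (p. 222), §13.8 (pp. 228–229)] [cite: GreenbergLNM1716, §1 (p. 60)] -/
theorem fine_lengthAt_eq_zero_of_sharpFlatUnitContent_contra_inv
    (hCKc : thm714seq_sharpFlatColemanKato_zeta_contra)
    (hp : p ≠ 2) (hgood : W.HasGoodReductionAtPrime p) (hap : (p : ℤ) ∣ W.frobeniusTrace p)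
    (hns : ¬ W.HasSurjectiveModNGaloisRep p)
    {N : ℕ} [NeZero N] (f : CuspForm (Gamma0 N) 2) (hf : IsNewformOf W f)
    (ϖ : ℚ) (hϖ : (ϖ : ℝ) * W.realPeriodRat = plusPeriod f) (hϖ1 : ‖(ϖ : ℚ_[p])‖ = 1)
    (κ : ZpExtension ℚ p) (γ : absoluteGaloisGroup ℚ) (hκ : κ.IsCyclotomic) (hγ : κ.IsTopGenerator γ)
    (hγ' : IsCyclotomicVariable p γ)
    (v : HeightOneSpectrum (𝓞 ℚ)) (hv : (p : 𝓞 ℚ) ∈ v.asIdeal)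
    (g : absoluteGaloisGroup (v.adicCompletion ℚ))
    (hg : κ.IsTopGenerator (resGalOfEmb (closureEmb (K := ℚ) (v.adicCompletion ℚ)) g))
    (cneg : localPoints W (v.adicCompletion ℚ)) (c : ℕ → localPoints W (v.adicCompletion ℚ))
    (hH : IsHondaSystem κ (closureEmb (K := ℚ) (v.adicCompletion ℚ)) W (W.frobeniusTrace p) g cneg c)
    (col₀ : Chroma) {Lsharp Lflat : IwasawaAlgebra p}
    (hSP : IsSprungPair f p (W.frobeniusTrace p) Lsharp Lflat)
    (hu₀ : HasUnitContent (chromaticL col₀ Lsharp Lflat))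
    (Y' : W.FineSelmerDualData κ γ⁻¹) (𝔭 : PrimeSpectrum (IwasawaAlgebra p))
    (h𝔭 : 𝔭.asIdeal = IwasawaAlgebra.augIdealP p) :
    Module.lengthAt (IwasawaAlgebra p) Y'.X 𝔭 = 0 := by
  obtain ⟨Y⟩ := W.nonempty_fineSelmerDualData κ hγ
  rw [Kato2004.fineSelmerDualData_lengthAt_inv_eq_of_asIdeal_eq_augIdealP Y Y' 𝔭 h𝔭]
  exact fine_lengthAt_eq_zero_of_sharpFlatUnitContent_contra W p hCKc hp hgood hap hns f hf ϖ hϖ hϖ1 κ γ hκ hγ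
    hγ' v hv g hg cneg c hH col₀ hSP hu₀ Y 𝔭 h𝔭

end FineZero

/-! ### §2 LEMMA B in print keying: `ℓ_{(p)} X₀ = 0 ⟹ ℓ_{(p)} X^• ≤ ℓ_{(p)} Λ/(L^•)` for the `γ⁻¹`-keyed duals -/

section LemmaB

variable (W : WeierstrassCurve ℚ) [W.IsElliptic] [W.IsGloballyMinimal] (p : ℕ) [Fact p.Prime]

/-- **LEMMA B (♯/♭), print keying: `ℓ_{(p)} X₀(γ⁻¹) = 0 ⟹ ℓ_{(p)} X^•(γ⁻¹) ≤ ℓ_{(p)} Λ/(L^•)`, ANY image, ANY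
supersingular `a_p`** (odd good `p ∣ a_p`, newform `f`, period ratio `ϖ` of norm `1` displayed, cyclotomic/Honda setting,
colour `•`, Sprung pair with `L^• ≠ 0`, `γ⁻¹`-keyed dual data `D`, `Y`). Binder: the one-colour contragredient package
fact `hCKc` (its field `exact` through LEAD g6's `SharpFlatColemanKatoDataContra.lengthAt_le_fine_add`; `(G₁) = (L^•)` as
`ϖ` is a unit). Port of `PrintX8SharpFlatMuTransfer.sharpFlat_lengthAt_le_of_fine_lengthAt_eq_zero`.
[cite: Sprung2012, Thm. 7.14 (3) (p. 1504) and Prop. 7.19 (p. 1505)] [cite: Kato2004Asterisque, §17.13 (p. 280)] -/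
theorem sharpFlat_lengthAt_le_of_fine_lengthAt_eq_zero_contra (hCKc : thm714seq_sharpFlatColemanKato_zeta_contra)
    (hp : p ≠ 2) (hgood : W.HasGoodReductionAtPrime p) (hap : (p : ℤ) ∣ W.frobeniusTrace p)
    {N : ℕ} [NeZero N] (f : CuspForm (Gamma0 N) 2) (hf : IsNewformOf W f)
    (ϖ : ℚ) (hϖ : (ϖ : ℝ) * W.realPeriodRat = plusPeriod f) (hϖ1 : ‖(ϖ : ℚ_[p])‖ = 1)
    (κ : ZpExtension ℚ p) (γ : absoluteGaloisGroup ℚ) (hκ : κ.IsCyclotomic) (hγ : κ.IsTopGenerator γ)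
    (hγ' : IsCyclotomicVariable p γ)
    (v : HeightOneSpectrum (𝓞 ℚ)) (hv : (p : 𝓞 ℚ) ∈ v.asIdeal)
    (g : absoluteGaloisGroup (v.adicCompletion ℚ))
    (hg : κ.IsTopGenerator (resGalOfEmb (closureEmb (K := ℚ) (v.adicCompletion ℚ)) g))
    (cneg : localPoints W (v.adicCompletion ℚ)) (c : ℕ → localPoints W (v.adicCompletion ℚ))
    (hH : IsHondaSystem κ (closureEmb (K := ℚ) (v.adicCompletion ℚ)) W (W.frobeniusTrace p) g cneg c)
    (col : Chroma) {Lsharp Lflat : IwasawaAlgebra p}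
    (hSP : IsSprungPair f p (W.frobeniusTrace p) Lsharp Lflat) (hcol : chromaticL col Lsharp Lflat ≠ 0)
    (D : SharpFlatSelmerDualData W κ γ⁻¹ (closureEmb (K := ℚ) (v.adicCompletion ℚ))
      (W.frobeniusTrace p) g c col)
    (Y : W.FineSelmerDualData κ γ⁻¹) (𝔭 : PrimeSpectrum (IwasawaAlgebra p))
    (h𝔭 : 𝔭.asIdeal = IwasawaAlgebra.augIdealP p) (hY : Module.lengthAt (IwasawaAlgebra p) Y.X 𝔭 = 0) :
    Module.lengthAt (IwasawaAlgebra p) D.X 𝔭 ≤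
      Module.lengthAt (IwasawaAlgebra p)
        (IwasawaAlgebra p ⧸ Ideal.span {chromaticL col Lsharp Lflat}) 𝔭 := by
  haveI : ContinuousSMul ℤ_[p] (W.tateModule p) := TateModule.continuousSMul_padicInt
  haveI : Module.Free ℤ_[p] (W.tateModule p) := W.module_free_tateModule_holds p
  haveI : Module.Finite ℤ_[p] (W.tateModule p) := W.module_finite_tateModule_holds p
  have hirr : W.HasIrreducibleModPGaloisRep p :=
    hasIrreducibleModPGaloisRep_of_dvd_frobeniusTrace W p hp
      (W.not_dvd_minimalDiscriminantInt_of_hasGoodReductionAtPrime' p hgood) hap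
  obtain ⟨I⟩ := nonempty_iwasawaH1Data_holds W p κ γ hκ hγ
  obtain ⟨C⟩ := hCKc W p f ϖ κ γ hp hgood hap hf hϖ hκ hγ hγ' v hv g hg cneg c hH col I
  -- the period unit: `G₁ := C(u)·L^•` is Néron-normalised and `(G₁) = (L^•)`
  set L : IwasawaAlgebra p := chromaticL col Lsharp Lflat with hLdef
  obtain ⟨hspan, hι⟩ := span_C_units_mul_eq (PadicInt.mkUnits hϖ1) L
  have hG₁ : iwasawaToPowerSeries p (PowerSeries.C ((PadicInt.mkUnits hϖ1 : ℤ_[p]ˣ) : ℤ_[p]) * L) =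
      PowerSeries.C ((ϖ : ℚ) : ℚ_[p]) * iwasawaToPowerSeries p L := by rw [hι, PadicInt.mkUnits_eq]
  have h𝔭1 : 𝔭.asIdeal.height = 1 := by rw [h𝔭]; exact IwasawaAlgebra.height_augIdealP_holds p
  have h := C.lengthAt_le_fine_add W p hirr hSP hcol hG₁ D Y 𝔭 h𝔭1
  rwa [hY, zero_add, hspan] at h

/-- **LEMMA B in `μ`-currency on X8, print keying** (the period unit `|ϖ|₃ = 1` DISCHARGED by the period fact at `3`):
`ℓ_{(3)} X₀(γ⁻¹) = 0` for every fine datum ⟹ `μ(D.X) ≤ μ(Λ/(L^•))` for the `γ⁻¹`-keyed `D` of every colour with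
`L^• ≠ 0`. Binders: `hCKc`, `h3`. Port of `PrintX8SharpFlatMuTransfer.X8.sharpFlatMu_le_of_fine_lengthAt_eq_zero`.
[cite: Sprung2012, Prop. 7.19 (p. 1505)] [cite: Washington1997, §13.2] [cite: GreenbergVatsal2000, §3 Remark 3.4] -/
theorem X8.sharpFlatMu_le_of_fine_lengthAt_eq_zero_contra (hCKc : thm714seq_sharpFlatColemanKato_zeta_contra)
    (h3 : realPeriodRat_eq_unit_mul_plusPeriod_three) (hX : ClassX8 W p)
    {N : ℕ} [NeZero N] (f : CuspForm (Gamma0 N) 2) (hf : IsNewformOf W f)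
    (ϖ : ℚ) (hϖ : (ϖ : ℝ) * W.realPeriodRat = plusPeriod f)
    (κ : ZpExtension ℚ p) (γ : absoluteGaloisGroup ℚ) (hκ : κ.IsCyclotomic) (hγ : κ.IsTopGenerator γ)
    (hγ' : IsCyclotomicVariable p γ)
    (v : HeightOneSpectrum (𝓞 ℚ)) (hv : (p : 𝓞 ℚ) ∈ v.asIdeal)
    (g : absoluteGaloisGroup (v.adicCompletion ℚ))
    (hg : κ.IsTopGenerator (resGalOfEmb (closureEmb (K := ℚ) (v.adicCompletion ℚ)) g))
    (cneg : localPoints W (v.adicCompletion ℚ)) (c : ℕ → localPoints W (v.adicCompletion ℚ))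
    (hH : IsHondaSystem κ (closureEmb (K := ℚ) (v.adicCompletion ℚ)) W (W.frobeniusTrace p) g cneg c)
    (col : Chroma) {Lsharp Lflat : IwasawaAlgebra p}
    (hSP : IsSprungPair f p (W.frobeniusTrace p) Lsharp Lflat) (hcol : chromaticL col Lsharp Lflat ≠ 0)
    (D : SharpFlatSelmerDualData W κ γ⁻¹ (closureEmb (K := ℚ) (v.adicCompletion ℚ))
      (W.frobeniusTrace p) g c col)
    (hY : ∀ Y : W.FineSelmerDualData κ γ⁻¹, ∀ 𝔭 : PrimeSpectrum (IwasawaAlgebra p),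
      𝔭.asIdeal = IwasawaAlgebra.augIdealP p → Module.lengthAt (IwasawaAlgebra p) Y.X 𝔭 = 0) :
    muInvariant p D.X ≤ muInvariant p (IwasawaAlgebra p ⧸ Ideal.span {chromaticL col Lsharp Lflat}) := by
  let 𝔭 : PrimeSpectrum (IwasawaAlgebra p) :=
    ⟨IwasawaAlgebra.augIdealP p, IwasawaAlgebra.isPrime_augIdealP_holds p⟩
  have hϖ1 : ‖(ϖ : ℚ_[p])‖ = 1 := X8_norm_periodRatio_eq_one h3 W p hX hf hϖ
  obtain ⟨hp3, ⟨hgood, hap⟩, -⟩ := hX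
  subst hp3
  obtain ⟨Y⟩ := W.nonempty_fineSelmerDualData' (κ := κ) γ⁻¹
  have hle := sharpFlat_lengthAt_le_of_fine_lengthAt_eq_zero_contra W 3 hCKc (by decide) hgood hap f hf ϖ hϖ hϖ1 κ
    γ hκ hγ hγ' v hv g hg cneg c hH col hSP hcol D Y 𝔭 rfl (hY Y 𝔭 rfl)
  rw [muInvariant_eq_toNat_lengthAt 3 D.X 𝔭 rfl,
    muInvariant_eq_toNat_lengthAt 3 (IwasawaAlgebra 3 ⧸ Ideal.span {chromaticL col Lsharp Lflat}) 𝔭 rfl]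
  exact ENat.toNat_le_toNat hle (lengthAt_quotient_span_ne_top hcol 𝔭 rfl)

end LemmaB

/-! ### §3 PER PAIR, print keying: ONE colour's rider ⟹ the `μ`-bound for EVERY colour's `γ⁻¹`-keyed dual -/

section OneColour

variable (W : WeierstrassCurve ℚ) [W.IsElliptic] [W.IsGloballyMinimal] (p : ℕ) [Fact p.Prime]

/-- **X8, `ρ̄_{E,3}` NOT onto: ONE colour `•₀` of unit content ⟹ `μ(X^•(γ⁻¹)) ≤ μ(Λ/(L^•))` for EVERY colour `•` with
`L^• ≠ 0`** (same newform / Sprung pair / cyclotomic–Honda datum), print keying: §1 (`ℓ_{(3)} X₀ = 0` from the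
`•₀`-rider through the contragredient package) ∘ §2 (LEMMA B). Binders: `hCKc`, `h3`; displayed: `hu₀`. NO K1, NO
partner, NO congruence. Port of `PrintX8SharpFlatMuTransfer.X8.sharpFlatMu_le_of_oneColour_hasUnitContent`.
[cite: Sprung2012, Def. 6.1 (p. 1495), Prop. 7.19 (p. 1505)] [cite: Kato2004Asterisque, Thm. 12.6 (p. 222), §13.8, §17.13 (p. 280)] -/
theorem X8.sharpFlatMu_le_of_oneColour_hasUnitContent_contra (hCKc : thm714seq_sharpFlatColemanKato_zeta_contra)
    (h3 : realPeriodRat_eq_unit_mul_plusPeriod_three) (hX : ClassX8 W p) (hns : ¬ Surj W p)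
    {N : ℕ} [NeZero N] (f : CuspForm (Gamma0 N) 2) (hf : IsNewformOf W f)
    (ϖ : ℚ) (hϖ : (ϖ : ℝ) * W.realPeriodRat = plusPeriod f)
    (κ : ZpExtension ℚ p) (γ : absoluteGaloisGroup ℚ) (hκ : κ.IsCyclotomic) (hγ : κ.IsTopGenerator γ)
    (hγ' : IsCyclotomicVariable p γ)
    (v : HeightOneSpectrum (𝓞 ℚ)) (hv : (p : 𝓞 ℚ) ∈ v.asIdeal)
    (g : absoluteGaloisGroup (v.adicCompletion ℚ))
    (hg : κ.IsTopGenerator (resGalOfEmb (closureEmb (K := ℚ) (v.adicCompletion ℚ)) g))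
    (cneg : localPoints W (v.adicCompletion ℚ)) (c : ℕ → localPoints W (v.adicCompletion ℚ))
    (hH : IsHondaSystem κ (closureEmb (K := ℚ) (v.adicCompletion ℚ)) W (W.frobeniusTrace p) g cneg c)
    {Lsharp Lflat : IwasawaAlgebra p} (hSP : IsSprungPair f p (W.frobeniusTrace p) Lsharp Lflat)
    (col₀ : Chroma) (hu₀ : HasUnitContent (chromaticL col₀ Lsharp Lflat))
    (col : Chroma) (hcol : chromaticL col Lsharp Lflat ≠ 0)
    (D : SharpFlatSelmerDualData W κ γ⁻¹ (closureEmb (K := ℚ) (v.adicCompletion ℚ))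
      (W.frobeniusTrace p) g c col) :
    muInvariant p D.X ≤ muInvariant p (IwasawaAlgebra p ⧸ Ideal.span {chromaticL col Lsharp Lflat}) := by
  refine X8.sharpFlatMu_le_of_fine_lengthAt_eq_zero_contra W p hCKc h3 hX f hf ϖ hϖ κ γ hκ hγ hγ' v hv g hg cneg c
    hH col hSP hcol D fun Y 𝔭 h𝔭 ↦ ?_
  have hϖ1 : ‖(ϖ : ℚ_[p])‖ = 1 := X8_norm_periodRatio_eq_one h3 W p hX hf hϖ
  obtain ⟨hp3, ⟨hgood, hap⟩, -⟩ := hX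
  subst hp3
  exact fine_lengthAt_eq_zero_of_sharpFlatUnitContent_contra_inv W 3 hCKc (by decide) hgood hap hns f hf ϖ hϖ hϖ1
    κ γ hκ hγ hγ' v hv g hg cneg c hH col₀ hSP hu₀ Y 𝔭 h𝔭

end OneColour

/-! ### §4 CLASS FORMS: THEOREM B + the contragredient package ⟹ the `μ`-bound on every small-image X8 pair, print keying -/

/-- **The small-image `μ`-bound in PRINT keying from THEOREM B's conclusion and the one-colour contragredient package**:
`ConjSpanGen N 3` at every level `N` prime to `3` (the body of `PrintX8VS[C].ConjSpanGenAll`, item 21705, PROVED) ⟹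
`EisSpanModGen N 3` (`eisSpanModGen_of_conjSpanGen`) ⟹ VS-1 on every small-image X8 pair
(`PrintX8VerticalStevens.cycWindingNonConstantSmallImageX8_of_spanModAtThree`) ⟹ ONE colour of unit content
(`ClassX8.exists_hasUnitContent_chromaticL_of_cycWindingNonConstant`) ⟹ §3: for every X8 pair with `ρ̄_{E,3}` not onto,
every colour `•`, every cyclotomic/Honda/newform/period/Sprung-pair instance with `L^• ≠ 0` and every `γ⁻¹`-keyed dual
datum `D` of `Sel^•(E/ℚ_∞)`: `μ(D.X) ≤ μ(Λ/(L^•))`. Port of `PrintX8VSGlue.muBoundSmallImageX8_of_conjSpanGenAll` ∘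
`PrintX8VerticalStevens.muBoundSmallImageX8_of_cycWindingNonConstantSmallImageX8` (the statement = the body of
`PrintX8.MuBoundSmallImageX8` with the `γ⁻¹` key, the period ratio `ϖ` as a binder and no analytic-rank binder).
CONDITIONAL on the displayed `hCKc` (print) and `h3` (print); closes nothing. [cite: Pollack2003, Def. 6.15]
[cite: Sprung2017, Cor. 4.10 and Thm. 1.12] [cite: Sprung2012, Def. 6.1, Thm. 7.14 (3) and Prop. 7.19]
[cite: Kato2004Asterisque, Thm. 12.6 (p. 222), §13.8] -/
theorem muBoundSmallImageContra_of_conjSpanGen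
    (hSpan : ∀ (N p : ℕ), p.Prime → ¬ p ∣ N → ConjSpanGen N p)
    (hCKc : thm714seq_sharpFlatColemanKato_zeta_contra) (h3 : realPeriodRat_eq_unit_mul_plusPeriod_three) :
    ∀ (W : WeierstrassCurve ℚ) [W.IsElliptic] [W.IsGloballyMinimal] (p : ℕ) [Fact p.Prime],
      ClassX8 W p → ¬ Surj W p → ∀ (col : Chroma) (κ : ZpExtension ℚ p) (γ : Field.absoluteGaloisGroup ℚ),
      κ.IsCyclotomic → κ.IsTopGenerator γ → IsCyclotomicVariable p γ →
    ∀ (v : HeightOneSpectrum (𝓞 ℚ)), (p : 𝓞 ℚ) ∈ v.asIdeal →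
    ∀ (g : Field.absoluteGaloisGroup (v.adicCompletion ℚ)),
      κ.IsTopGenerator (resGalOfEmb (closureEmb (K := ℚ) (v.adicCompletion ℚ)) g) →
    ∀ (cneg : localPoints W (v.adicCompletion ℚ)) (c : ℕ → localPoints W (v.adicCompletion ℚ)),
      IsHondaSystem κ (closureEmb (K := ℚ) (v.adicCompletion ℚ)) W (W.frobeniusTrace p) g cneg c →
    ∀ (N : ℕ) (_ : NeZero N) (f : CuspForm (Gamma0 N) 2) (ϖ : ℚ) (Lsharp Lflat : IwasawaAlgebra p),
      IsNewformOf W f → (ϖ : ℝ) * W.realPeriodRat = plusPeriod f →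
      IsSprungPair f p (W.frobeniusTrace p) Lsharp Lflat → chromaticL col Lsharp Lflat ≠ 0 →
    ∀ D : SharpFlatSelmerDualData W κ γ⁻¹ (closureEmb (K := ℚ) (v.adicCompletion ℚ))
        (W.frobeniusTrace p) g c col,
      muInvariant p D.X ≤ muInvariant p (IwasawaAlgebra p ⧸ Ideal.span {chromaticL col Lsharp Lflat}) := by
  intro W _ _ p _ hX hns col κ γ hκ hγ hγ' v hv g hg cneg c hH N hN f ϖ Lsharp Lflat hf hϖ hSP hcol D
  haveI := hN
  -- VS-0 (mod 3) ⟹ VS-1 at the pair ⟹ ONE colour `col₀` of unit content (keying-free)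
  have hVS := PrintX8VerticalStevens.cycWindingNonConstantSmallImageX8_of_spanModAtThree
    (fun M _ h3M ↦ eisSpanModGen_of_conjSpanGen (hSpan M 3 Nat.prime_three h3M)) W p hX hns N hN f hf
  obtain ⟨col₀, hu₀⟩ := ClassX8.exists_hasUnitContent_chromaticL_of_cycWindingNonConstant hX hf hSP hVS
  exact X8.sharpFlatMu_le_of_oneColour_hasUnitContent_contra W p hCKc h3 hX hns f hf ϖ hϖ κ γ hκ hγ hγ' v hv g
    hg cneg c hH hSP col₀ hu₀ col hcol D

/-- **The same from the JOINT contragredient package** `thm714seq_sharpFlatColemanKato_zetaJoint_contra` (conjunct (3) of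
`PrintX8VSC.HeldInputsX8RContra`; the one-colour package by the PROVED projection
`thm714seq_sharpFlatColemanKato_zeta_contra_of_joint`). [cite: Sprung2012, Def. 7.12 (p. 1503), Thm. 7.14 (3) (p. 1504)]
[cite: Pollack2003, Def. 6.15] -/
theorem muBoundSmallImageContra_of_conjSpanGen_of_zetaJoint
    (hSpan : ∀ (N p : ℕ), p.Prime → ¬ p ∣ N → ConjSpanGen N p)
    (hJc : thm714seq_sharpFlatColemanKato_zetaJoint_contra) (h3 : realPeriodRat_eq_unit_mul_plusPeriod_three) :
    ∀ (W : WeierstrassCurve ℚ) [W.IsElliptic] [W.IsGloballyMinimal] (p : ℕ) [Fact p.Prime],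
      ClassX8 W p → ¬ Surj W p → ∀ (col : Chroma) (κ : ZpExtension ℚ p) (γ : Field.absoluteGaloisGroup ℚ),
      κ.IsCyclotomic → κ.IsTopGenerator γ → IsCyclotomicVariable p γ →
    ∀ (v : HeightOneSpectrum (𝓞 ℚ)), (p : 𝓞 ℚ) ∈ v.asIdeal →
    ∀ (g : Field.absoluteGaloisGroup (v.adicCompletion ℚ)),
      κ.IsTopGenerator (resGalOfEmb (closureEmb (K := ℚ) (v.adicCompletion ℚ)) g) →
    ∀ (cneg : localPoints W (v.adicCompletion ℚ)) (c : ℕ → localPoints W (v.adicCompletion ℚ)),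
      IsHondaSystem κ (closureEmb (K := ℚ) (v.adicCompletion ℚ)) W (W.frobeniusTrace p) g cneg c →
    ∀ (N : ℕ) (_ : NeZero N) (f : CuspForm (Gamma0 N) 2) (ϖ : ℚ) (Lsharp Lflat : IwasawaAlgebra p),
      IsNewformOf W f → (ϖ : ℝ) * W.realPeriodRat = plusPeriod f →
      IsSprungPair f p (W.frobeniusTrace p) Lsharp Lflat → chromaticL col Lsharp Lflat ≠ 0 →
    ∀ D : SharpFlatSelmerDualData W κ γ⁻¹ (closureEmb (K := ℚ) (v.adicCompletion ℚ))
        (W.frobeniusTrace p) g c col,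
      muInvariant p D.X ≤ muInvariant p (IwasawaAlgebra p ⧸ Ideal.span {chromaticL col Lsharp Lflat}) :=
  muBoundSmallImageContra_of_conjSpanGen hSpan (thm714seq_sharpFlatColemanKato_zeta_contra_of_joint hJc) h3

end Summit.BirchSwinnertonDyer.BirchSwinnertonDyer.Theorems.X8MainConjectureContra

end
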